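import Mathlib.AlgebraicGeometry.EllipticCurve.IsomOfJ
import Literature.NumberTheory.EllipticCurves.TateCurve.Invariants
import Literature.NumberTheory.EllipticCurves.TateCurve.Uniformization
import Literature.NumberTheory.EllipticCurves.TateCurve.Discriminant
import Literature.NumberTheory.EllipticCurves.TateCurve.ValuationRing
import Literature.NumberTheory.EllipticCurves.TateCurve.Reduction
import Literature.NumberTheory.EllipticCurves.TateCurve.SquareLemma
import Literature.NumberTheory.EllipticCurves.TateCurve.Twist
import Literature.NumberTheory.EllipticCurves.TateCurve.SplitGamma
import Literature.NumberTheory.EllipticCurves.TateCurve.Henselian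
import HarnessLib

/-!
# Discharges for the Tate-curve named facts: V.3.1 (b), V.5.3 (a), (b), AEC VII.5.1 (b) — PROVED

Topic `Literature/NumberTheory/EllipticCurves/TateCurve`, namespace
`Literature.NumberTheory.EllipticCurves.TateCurve` (abc-iut cell, TRANCHE-T1 P21). This file
proves four of the five named facts stated in `TateCurve/Invariants.lean` and
`TateCurve/Uniformization.lean` (all but `uniformization`, the analytic parametrisation
`K̄^*/q^ℤ ⥲ E_q(K̄)` of ATAEC V.3.1 (c), (d)):

* `discr_eq_tateDelta_holds` — Silverman ATAEC Thm. V.3.1 (b), `Δ(E_q) = q ∏ (1 - qⁿ)²⁴`: the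
  one-line wrapper around `tateCurve_discr` (`TateCurve/Discriminant.lean`, where the proof —
  level-one identity `E₄³ - E₆² = 1728Δ` transported to `ℤ⟦q⟧` and evaluated — lives).
* `isomorphic_tateCurve_of_one_lt_norm_j_holds` — Silverman ATAEC Thm. V.5.3 (a): an elliptic
  curve `E/K` with `|j(E)| > 1` over a complete ultrametric field of characteristic `0` is
  isomorphic over `K̄` to `E_q` for a (unique) `q ∈ K`, `0 < |q| < 1`, `j(E_q) = j(E)`.  Proof as
  printed (PDF p. 408): "From (5.1) there is a unique `q` … such that `j(E_q) = j(E)`" — the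
  tree's PROVED Lemma V.5.1 `existsUnique_tateJ_eq_of_one_lt_norm` together with
  `j(E_q) = tateJ q` (`tateCurve_j`) — "This implies [AEC, III.1.4b] that `E_q` is isomorphic to
  `E` over `K̄`" — Mathlib's `WeierstrassCurve.exists_variableChange_of_j_eq` (elliptic curves
  with the same `j` over a separably closed field are isomorphic).
* `one_lt_norm_j_of_hasMultiplicativeReduction_holds` — Silverman AEC Prop. VII.5.1 (b), local
  form: a minimal Weierstrass equation with multiplicative reduction (`v(Δ) > 0`, `v(c₄) = 0`,
  Mathlib's `WeierstrassCurve.HasMultiplicativeReduction R`) has `|j| = |c₄|³/|Δ| = 1/|Δ| > 1`;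
  through the dictionary between Mathlib's `v`-adic valuation of the discrete valuation ring `R`
  (`IsDedekindDomain.HeightOneSpectrum.valuation K (maximalIdeal R)`) and the norm of `K`
  (`TateCurve/ValuationRing.lean`: `valuation_eq_one_iff_norm_eq_one`,
  `valuation_lt_one_iff_norm_lt_one`, from the compatibility `‖x‖ ≤ 1 ↔ x ∈ R`).

* `splitMultiplicative_tfae_holds` — Silverman ATAEC Thm. V.5.3 (b), assembled from
  (i) ⇒ (ii) `isSquare_gamma_of_iso_tateCurve` (`SquareLemma.lean`: Lemma V.5.3.1 via the
  Catalan series, `γ(E_q/K) = 1`), (ii) ⇒ (i) `iso_tateCurve_of_isSquare_gamma` (`Twist.lean`: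
  Lemma V.5.2 (b)), (i) ⇒ (iii) `splitMultiplicative_of_iso_tateCurve` (`Reduction.lean`: the
  Tate equation is minimal with split multiplicative reduction) and (iii) ⇒ (ii)
  `isSquare_gamma_of_hasSplitMultiplicativeReduction` (`SplitGamma.lean`: Hensel on the node
  polynomial, `disc = -c₄c₆`) with `henselianLocalRing` (`Henselian.lean`: the ring of integers
  of the complete field `K` is Henselian).

Consequently `exists_tateParameter_of_hasSplitMultiplicativeReduction` (file `Uniformization`) is
now UNCONDITIONAL (`exists_tateParameter_of_hasSplitMultiplicativeReduction'`): an elliptic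
curve over a complete ultrametric field of characteristic `0` with split multiplicative
reduction is `K`-isomorphic to the Tate curve `E_q` for a unique `q`, `0 < |q| = |j|⁻¹ < 1`.
The only remaining named fact of the Tate-curve API is `uniformization` (V.3.1 (c),(d)).

## References
* [SilvermanATAEC1994] J. H. Silverman, *Advanced Topics in the Arithmetic of Elliptic Curves*,
  GTM 151, Springer 1994, Thm. V.3.1 (b), Lemma V.5.1, Thm. V.5.3 (a) and its proof
  (held copy PDF pp. 394–396, 405–408).
* [SilvermanAEC2009] J. H. Silverman, *The Arithmetic of Elliptic Curves*, 2nd ed., GTM 106,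
  Prop. VII.5.1 (b); III.1.4 (b).
-/

noncomputable section

open scoped Classical

open Field WeierstrassCurve IsDedekindDomain

namespace Literature.NumberTheory.EllipticCurves.TateCurve

open SteinWuthrich2013

universe u

/-! ### V.3.1 (b) -/

/-- **Silverman ATAEC Thm. V.3.1 (b), DISCHARGED**: the named fact `discr_eq_tateDelta`
(`Δ(E_q) = q ∏ (1 - qⁿ)²⁴` for `‖q‖ < 1` in a complete ultrametric field of characteristic `0`)
holds, by `tateCurve_discr`. [cite: SilvermanATAEC1994, Thm. V.3.1 (b) (PDF pp. 394–396)] -/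
theorem discr_eq_tateDelta_holds : discr_eq_tateDelta.{u} := by
  intro K _ _ _ _ q hq
  exact tateCurve_discr hq

/-! ### V.5.3 (a) -/

/-- **Silverman ATAEC Thm. V.5.3 (a) (Tate), DISCHARGED**: for an elliptic curve `E` over a
complete ultrametric field `K` of characteristic `0` with `|j(E)| > 1` there is `q ∈ K`,
`0 < |q| < 1`, with `j(E_q) = tateJ q = j(E)` and a change of variables over `K̄` carrying `E`
to `E_q`. Proof as printed (PDF p. 408): Lemma V.5.1 (tree:
`existsUnique_tateJ_eq_of_one_lt_norm`) gives `q` with `tateJ q = j(E)`; `E_q` is elliptic with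
`j(E_q) = tateJ q` (`tateCurve_isElliptic`, `tateCurve_j`); two elliptic curves over the
separably closed field `K̄` with the same `j`-invariant are isomorphic (Mathlib
`WeierstrassCurve.exists_variableChange_of_j_eq`, Silverman AEC III.1.4 (b)).
[cite: SilvermanATAEC1994, Thm. V.5.3 (a) (PDF pp. 407–408)] -/
theorem isomorphic_tateCurve_of_one_lt_norm_j_holds :
    isomorphic_tateCurve_of_one_lt_norm_j.{u} := by
  intro K _ _ _ _ E _ hj
  obtain ⟨q, ⟨hq0, hq, hqj⟩, -⟩ := existsUnique_tateJ_eq_of_one_lt_norm hj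
  refine ⟨q, hq0, hq, hqj, ?_⟩
  haveI : (tateCurve q).IsElliptic := tateCurve_isElliptic hq0 hq
  refine exists_variableChange_of_j_eq _ _ ?_
  change (E.map (algebraMap K (AlgebraicClosure K))).j =
    ((tateCurve q).map (algebraMap K (AlgebraicClosure K))).j
  rw [map_j, map_j, tateCurve_j hq, hqj]

/-! ### AEC VII.5.1 (b), local form -/

/-- **Silverman AEC Prop. VII.5.1 (b), local form, DISCHARGED**: a minimal Weierstrass equation
with multiplicative reduction (`v(Δ) > 0` and `v(c₄) = 0`, Mathlib
`WeierstrassCurve.HasMultiplicativeReduction R`, `R` the valuation ring of `‖·‖`) has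
`|j| = |c₄|³ / |Δ| = 1/|Δ| > 1`. The valuations are read through the dictionary of
`TateCurve/ValuationRing.lean` (`valuation_eq_one_iff_norm_eq_one`, `valuation_lt_one_iff_norm_lt_one`).
[cite: SilvermanAEC2009, Prop. VII.5.1 (b)] -/
theorem one_lt_norm_j_of_hasMultiplicativeReduction_holds :
    one_lt_norm_j_of_hasMultiplicativeReduction.{u} := by
  intro K _ _ _ _ R _ _ _ _ _ hR E _ hE
  -- `v(c₄) = 0`, i.e. `‖c₄‖ = 1`; `v(Δ) > 0`, i.e. `‖Δ‖ < 1`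
  have hnc : ‖E.c₄‖ = 1 := (valuation_eq_one_iff_norm_eq_one hR _).mp hE.multiplicativeReduction
  have hnd : ‖E.Δ‖ < 1 := (valuation_lt_one_iff_norm_lt_one hR _).mp hE.badReduction
  have hΔ0 : E.Δ ≠ 0 := E.isUnit_Δ.ne_zero
  -- `|j| = |c₄|³/|Δ| = 1/|Δ| > 1`
  have hj : E.j = E.c₄ ^ 3 / E.Δ := by
    rw [WeierstrassCurve.j, ← WeierstrassCurve.coe_Δ', Units.val_inv_eq_inv_val, div_eq_inv_mul]
  rw [hj, norm_div, norm_pow, hnc, one_pow, one_div]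
  exact one_lt_inv_iff₀.mpr ⟨norm_pos_iff.mpr hΔ0, hnd⟩

/-! ### V.5.3 (b) -/

/-- **Silverman ATAEC Thm. V.5.3 (b) (Tate), DISCHARGED**: for `E/K` over a complete ultrametric
field of characteristic `0` with `|j(E)| > 1`, Tate parameter `q` and ring of integers `R`
(`‖x‖ ≤ 1 ↔ x ∈ R`), TFAE: (i) `E ≅_K E_q`; (ii) `γ(E/K) = -c₄/c₆ ∈ K^{*2}`; (iii) some `K`-model
of `E` is a minimal equation with split multiplicative reduction. Assembled from the four
directions proved in `SquareLemma.lean`, `Twist.lean`, `Reduction.lean`, `SplitGamma.lean` +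
`Henselian.lean` (see the module docstring). [cite: SilvermanATAEC1994, Thm. V.5.3 (b) (PDF pp. 407–409)] -/
theorem splitMultiplicative_tfae_holds : splitMultiplicative_tfae.{u} := by
  intro K _ _ _ _ R _ _ _ _ _ hR E _ q hj hq0 hq hqj
  haveI : HenselianLocalRing R := henselianLocalRing hR
  tfae_have 1 → 2 := fun h ↦ isSquare_gamma_of_iso_tateCurve hq (by norm_num) h
  tfae_have 2 → 1 := fun h ↦ iso_tateCurve_of_isSquare_gamma E hj hq0 hq hqj h
  tfae_have 1 → 3 := fun h ↦ splitMultiplicative_of_iso_tateCurve R hR hq h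
  tfae_have 3 → 2 := fun h ↦ isSquare_gamma_of_hasSplitMultiplicativeReduction R E h
  tfae_finish

/-- **The Tate parameter of a curve with split multiplicative reduction — UNCONDITIONAL**
(ATAEC V.5.3 + AEC VII.5.1 (b), as consumed by [IUTchI] Def. 3.1 / [EtTh] §1): over a complete
ultrametric field `K` of characteristic `0` with ring of integers `R` (`‖x‖ ≤ 1 ↔ x ∈ R`), an
elliptic curve some `K`-model of which is a minimal equation with split multiplicative reduction
is `K`-isomorphic to `tateCurve q` for a `q ∈ K` with `q ≠ 0`, `‖q‖ < 1`, `tateJ q = j(E)`,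
`‖q‖ = ‖j(E)‖⁻¹` (unique by `tateParameter_unique`). This is
`exists_tateParameter_of_hasSplitMultiplicativeReduction` with its three fact-hypotheses
discharged. [cite: SilvermanATAEC1994, Thm. V.5.3 (PDF pp. 407–409)] -/
theorem exists_tateParameter_of_hasSplitMultiplicativeReduction'
    {K : Type u} [NontriviallyNormedField K] [CompleteSpace K] [IsUltrametricDist K] [CharZero K]
    (R : Type u) [CommRing R] [IsDomain R] [IsDiscreteValuationRing R] [Algebra R K]
    [IsFractionRing R K] (hR : ∀ x : K, ‖x‖ ≤ 1 ↔ x ∈ Set.range (algebraMap R K))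
    (E : WeierstrassCurve K) [E.IsElliptic]
    (hsplit : ∃ C : VariableChange K, WeierstrassCurve.HasSplitMultiplicativeReduction R (C • E)) :
    ∃ q : K, q ≠ 0 ∧ ‖q‖ < 1 ∧ tateJ q = E.j ∧ ‖q‖ = ‖E.j‖⁻¹ ∧
      ∃ C : VariableChange K, C • E = tateCurve q :=
  exists_tateParameter_of_hasSplitMultiplicativeReduction
    one_lt_norm_j_of_hasMultiplicativeReduction_holds isomorphic_tateCurve_of_one_lt_norm_j_holds
    splitMultiplicative_tfae_holds R hR E hsplit

end Literature.NumberTheory.EllipticCurves.TateCurve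

end
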